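import Literature.MathematicalPhysics.QuantumLattice.HubbardNNNHoppingCorrelatorCertificate
import HarnessLib

/-!
# `t–t'` Hubbard model: the WINDOW certificate with an energy constraint, read in the space-group-
# averaged vector state of every low-energy eigenvector of every large torus

Family `hubbard` (topic `MathematicalPhysics/QuantumLattice`). The window ("thermodynamic-limit
bootstrap") form of `hubbardTorusTT'_re_orbitState_ge_of_local_certificate_ineq`
(HubbardNNNHoppingCorrelatorCertificate): ONE identity in the window algebra `𝔄_{Λ'}` of a finite
window `Λ' ⊆ ℤ²` — objective `X ∈ 𝔄_{Λ'}`, density terms `Σ_σ μ_σ (n_{0σ} − ν·1)`, energy-constraint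
term `κ (u·1 − Γ(incl) E^{tt'}_Φ)` (Wang et al. 2024 §III), SOS + `[H^{tt'}_{Λ'}, B]` + affine-`D₄`
defects + charged words + anti-Hermitian parts + residual words (Han 2020 §3, all square-lattice
constraints) — proves, for EVERY `L ≥ 3` with `x ↦ x mod L` injective on `thicken Λ' 1`, every `n`,
every finite `S ∋ 1` closed under multiplication and containing the point-group elements `γₗ` of the
certificate, and every unit `ψ ∈ szSector (2n) 0` with `hubbardTorusTT' L t t' U ψ = E ψ`:

  `c − Σₖ ‖aₖ‖ + (Σ_σ μ_σ)(n/L² − ν) + κ (u − E/L²) ≤ Re ω̄_ψ(Γ(ι_{Λ',L}) X)`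

(`re_orbitState_ge_of_window_certificate_d4_TT'_ineq`; `ω̄_ψ = orbitState (spaceGroupUnitary S) ψ`).
Corollaries: with `κ ≥ 0` and `E/L² ≤ u` the `κ`-term drops (`…_of_energy_le`); for a ground state of
the sector, `E = groundEnergy (hubbardTorusTT' L t t' U) (2n)` (`…_groundState`). The bound is
UNIFORM IN `L` (same `c, a, μ, κ, u` for all tori) and holds for every vector of a degenerate ground
level — the form needed by finite-size correlator tables. The proof is the pull-back of
`groundEnergy_hubbardTorusTT'_div_ge_of_window_certificate_d4` (same dictionary: `Γ' ∘ Γ(incl) = Γ(ι)`,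
`hubbardTorusTT'_commutator_fermionEmbed`, `fermionEmbed_toTorusEmb_d4_sub`, charged words as
commutators with `N̂`, `S^z`), evaluated by `hubbardTorusTT'_re_orbitState_ge_of_local_certificate_ineq`.

## References
* J. Wang et al., PRX 14 (2024) 031006, §III. [cite: WangEtAl2024, §III]
* X. Han, arXiv:2006.06002 (2020), §3. [cite: Han2020Bootstrap, §3]
* H. Xu et al., Science 384 (2024) eadh7691, eq. (1). [cite: XuEtAl2024, eq. (1)]
-/

noncomputable section

namespace Literature.MathematicalPhysics.QuantumLattice

open Matrix Finset HubbardWave0 Literature.Probability.LatticeModels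
open Literature.MathematicalPhysics.QuantumManyBody.StateRelaxation
open scoped ComplexOrder BigOperators

section Window

variable {L : ℕ} [NeZero L]

/-- (Local to this section, as in `HubbardWindowCertificateD4` / `HubbardNNNHoppingWindowCertificateD4`.)
[folklore] -/
local instance (priority := high) instDecidableEqFermionTorusCorrWinTT : DecidableEq (FermionTorus 2 L) :=
  LinearOrder.toDecidableEq

/-- **Window certificate with an energy constraint and affine `D₄` reductions ⇒ space-group-averaged
expectation of a local observable in EVERY eigenvector of every large `t–t'` torus.** Data as in
`groundEnergy_hubbardTorusTT'_div_ge_of_window_certificate_d4` with an arbitrary objective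
`X ∈ 𝔄_{Λ'}` and an energy-constraint term: the identity in `𝔄_{Λ'}`
`X − c·1 − Σ_σ μ_σ (n_{0σ} − ν·1) − κ (u·1 − Γ(incl) E^{tt'}_Φ) = Σ Λₐᵦ Oₐᴴ O_b
  + (Σₖ (H^{tt'}_{Λ'} Bₖ − Bₖ H^{tt'}_{Λ'}) + Σₗ (Γ(incl)(Γ(d4Emb γₗ wₗ) Yₗ) − Γ(incl) Yₗ) + Σⱼ bⱼ • wⱼ)
  + (Σₘ dₘ • (Vₘᴴ − Vₘ) + Σₖ aₖ • vₖ)`.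
Then for every `L ≥ 3` with `x ↦ x mod L` injective on `thicken Λ' 1`, every `n`, every finite
`S ∋ 1` closed under multiplication with `γₗ ∈ S`, and every unit `ψ ∈ szSector (2n) 0` with
`hubbardTorusTT' L t t' U ψ = E ψ`:
`c − Σₖ ‖aₖ‖ + (Σ_σ μ_σ)(n/L² − ν) + κ (u − E/L²) ≤ Re ω̄_ψ(Γ(ι_{Λ',L}) X)`,
`ω̄_ψ = orbitState (spaceGroupUnitary S) ψ`. Wang et al. 2024 §III in Han's translation-invariant form
(2020 §3), read in the symmetrised state of an arbitrary eigenvector. [cite: WangEtAl2024, §III] -/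
theorem re_orbitState_ge_of_window_certificate_d4_TT'_ineq (t t' U : ℝ) (hL : 3 ≤ L) {nh : ℕ}
    {Λ Λ' : Finset (Site 2)} (hΛ : Λ ⊆ Λ') (h8 : thicken Λ 1 ⊆ Λ')
    (h0 : thicken ({0} : Finset (Site 2)) 1 ⊆ Λ') (hz : (0 : Site 2) ∈ Λ')
    (hInj : Set.InjOn (Torus.proj (d := 2) L) ↑(thicken Λ' 1))
    (hInj' : Set.InjOn (Torus.proj (d := 2) L) ↑Λ')
    {S : Finset (DihedralGroup 4)} (h1 : (1 : DihedralGroup 4) ∈ S) (hmul : ∀ a ∈ S, ∀ b ∈ S, a * b ∈ S)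
    {ψ : Fock (Orb (FermionTorus 2 L))}
    (hψK : ψ ∈ (szSector (2 * nh) 0 : Submodule ℂ (Fock (Orb (FermionTorus 2 L)))))
    (hψ1 : star ψ ⬝ᵥ ψ = 1) {E : ℝ} (hHψ : hubbardTorusTT' L t t' U *ᵥ ψ = (E : ℂ) • ψ)
    (Xw : FermionOp Λ') (κ u : ℝ) (μ : Fin 2 → ℝ) (ν : ℝ)
    {m : Type*} [Fintype m] [DecidableEq m] {Λm : Matrix m m ℂ} (hΛm : Λm.PosSemidef)
    (O : m → FermionOp Λ')
    {κ' : Type*} (s : Finset κ') (B : κ' → FermionOp Λ)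
    {ι : Type*} (tt : Finset ι) (γ : ι → DihedralGroup 4) (hγS : ∀ l ∈ tt, γ l ∈ S) (wv : ι → Site 2)
    (hsh : ∀ l, d4ShiftSet (γ l) (wv l) Λ ⊆ Λ') (Y : ι → FermionOp Λ)
    {ρ : Type*} (uu : Finset ρ) (b : ρ → ℂ) (cw : ρ → List (Orb (PolySite Λ') × Bool))
    (hcw : ∀ j ∈ uu, ladderCharge (cw j) ≠ 0 ∨ ladderSpinCharge (cw j) ≠ 0)
    {δ : Type*} (ah : Finset δ) (dc : δ → ℝ) (V : δ → FermionOp Λ')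
    {κ'' : Type*} (w : Finset κ'') (a : κ'' → ℂ) (word : κ'' → List (Orb (PolySite Λ') × Bool)) {c : ℝ}
    (hcert : Xw - (c : ℂ) • (1 : FermionOp Λ') -
        ∑ σ : Fin 2, ((μ σ : ℝ) : ℂ) • (nAt 0 hz σ - ((ν : ℝ) : ℂ) • (1 : FermionOp Λ')) -
        ((κ : ℝ) : ℂ) • (((u : ℝ) : ℂ) • (1 : FermionOp Λ') -
          fermionEmbed (PolySite.incl h0) ((hubbardTTPrimeFermionInteraction t t' U).meanEnergyObs 1)) =
      gramForm Λm O +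
        (∑ k ∈ s, ((hubbardTTPrimeFermionInteraction t t' U).localHamiltonian Λ' * fermionEmbed (PolySite.incl hΛ) (B k) -
            fermionEmbed (PolySite.incl hΛ) (B k) * (hubbardTTPrimeFermionInteraction t t' U).localHamiltonian Λ') +
          ∑ l ∈ tt, (fermionEmbed (PolySite.incl (hsh l)) (fermionEmbed (PolySite.d4Emb (γ l) (wv l) Λ) (Y l)) -
            fermionEmbed (PolySite.incl hΛ) (Y l)) +
          ∑ j ∈ uu, b j • ladderWord (cw j)) +
        (∑ m' ∈ ah, ((dc m' : ℝ) : ℂ) • ((V m')ᴴ - V m') + ∑ k ∈ w, a k • ladderWord (word k))) :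
    c - ∑ k ∈ w, ‖a k‖ + (∑ σ : Fin 2, μ σ) * ((nh : ℝ) / (L : ℝ) ^ 2 - ν) + κ * (u - E / (L : ℝ) ^ 2) ≤
      (orbitState (spaceGroupUnitary S) ψ (fermionEmbed (PolySite.toTorusEmb L hInj') Xw)).re := by
  have hInjΛ : Set.InjOn (Torus.proj (d := 2) L) ↑Λ := hInj'.mono (by exact_mod_cast hΛ)
  have hInj0 : Set.InjOn (Torus.proj (d := 2) L) ↑(thicken ({0} : Finset (Site 2)) 1) :=
    hInj'.mono (by exact_mod_cast h0)
  set Γ' := fermionEmbed (PolySite.toTorusEmb L hInj') with hΓ'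
  set ΓΛ := fermionEmbed (PolySite.toTorusEmb L hInjΛ) with hΓΛ
  set H := hubbardTorusTT' L t t' U with hH
  set EΦ := (hubbardTTPrimeFermionInteraction t t' U).meanEnergyObs 1 with hEΦ
  -- the local energy `Γ(ι₀) E_Φ`, whose translates sum to `H`
  set X := Γ' (fermionEmbed (PolySite.incl h0) EΦ) with hX
  have hX0 : X = fermionEmbed (PolySite.toTorusEmb L hInj0) EΦ := fermionEmbed_toTorusEmb_incl h0 hInj' EΦ
  have hsum : ∑ v' : TorusSite 2 L, (fockTranslate v').val * X * (fockTranslate v').valᴴ = H := by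
    rw [hX0]
    have h := sum_relabel_translate_hubbardTTPrime_meanEnergyObs (L := L) t' t U hL
    simp_rw [relabel_eq_fockRelabel_conj] at h
    exact h
  -- density observables
  set D : Fin 2 → Matrix (Finset (Orb (FermionTorus 2 L))) (Finset (Orb (FermionTorus 2 L))) ℂ :=
    fun σ => numberOp (FermionTorus.ofTorusSite (0 : TorusSite 2 L)) σ with hD
  set G : Fin 2 → Matrix (Finset (Orb (FermionTorus 2 L))) (Finset (Orb (FermionTorus 2 L))) ℂ :=
    fun σ => ∑ y : FermionTorus 2 L, numberOp y σ with hG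
  have hDΓ : ∀ σ, Γ' (nAt 0 hz σ) = D σ := fun σ => fermionEmbed_toTorusEmb_nAt_zero hz hInj' σ
  have hDsum : ∀ σ ∈ (Finset.univ : Finset (Fin 2)),
      ∑ v' : TorusSite 2 L, (fockTranslate v').val * D σ * (fockTranslate v').valᴴ = G σ :=
    fun σ _ => sum_conj_fockTranslate_numberOp 0 σ
  have hGs : ∀ σ ∈ (Finset.univ : Finset (Fin 2)),
      ∀ φ ∈ (szSector (2 * nh) 0 : Submodule ℂ (Fock (Orb (FermionTorus 2 L)))),
        G σ *ᵥ φ = (((nh : ℝ) : ℝ) : ℂ) • φ := by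
    intro σ _ φ hφ
    rw [hG, spinNumber_mulVec_of_mem_szSector σ hφ]
    congr 1
    push_cast
    ring
  -- symmetry family: affine `D₄` maps, as torus matrices
  set Yt : ι → Matrix (Finset (Orb (FermionTorus 2 L))) (Finset (Orb (FermionTorus 2 L))) ℂ :=
    fun l => ΓΛ (Y l) with hYt
  -- charge family (charged words as commutators with `N̂` / `S^z`, both real scalars on the sector)
  set emb : Orb (PolySite Λ') × Bool → Orb (FermionTorus 2 L) × Bool :=
    fun p => (Orb.embMap (PolySite.toTorusEmb L hInj') p.1, p.2) with hemb
  set C : ρ → Matrix (Finset (Orb (FermionTorus 2 L))) (Finset (Orb (FermionTorus 2 L))) ℂ :=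
    fun j => if ladderCharge ((cw j).map emb) ≠ 0 then totalNumber else HubbardWave0.spinZ with hC
  set W : ρ → Matrix (Finset (Orb (FermionTorus 2 L))) (Finset (Orb (FermionTorus 2 L))) ℂ :=
    fun j => (b j / (if ladderCharge ((cw j).map emb) ≠ 0 then ((ladderCharge ((cw j).map emb) : ℤ) : ℂ)
      else ((ladderSpinCharge ((cw j).map emb) : ℤ) : ℂ) / 2)) • ladderWord ((cw j).map emb) with hW
  set qc : ρ → ℝ := fun j => if ladderCharge ((cw j).map emb) ≠ 0 then ((2 * nh : ℕ) : ℝ) else 0 with hqc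
  have hCh : ∀ j ∈ uu, (C j).IsHermitian := by
    intro j _
    by_cases hq : ladderCharge ((cw j).map emb) ≠ 0
    · simp only [hC, hq, ne_eq, not_false_eq_true, if_true]
      show (totalNumber)ᴴ = totalNumber
      rw [totalNumber_eq_numberDiag_univ]
      exact numberDiag_conjTranspose _
    · simp only [hC, hq, if_false]; exact HubbardWave0.spinZ_isHermitian
  have hCq : ∀ j ∈ uu, ∀ φ ∈ (szSector (2 * nh) 0 : Submodule ℂ (Fock (Orb (FermionTorus 2 L)))),
      C j *ᵥ φ = ((qc j : ℝ) : ℂ) • φ := by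
    intro j _ φ hφ
    obtain ⟨hNφ, hSφ⟩ := (mem_szSector_iff _ _ φ).1 hφ
    by_cases hq : ladderCharge ((cw j).map emb) ≠ 0
    · simp only [hC, hqc, hq, ne_eq, not_false_eq_true, if_true]
      rw [totalNumber_mulVec_of_isNParticle hNφ]
      push_cast
      rfl
    · simp only [hC, hqc, hq, if_false]
      rw [hSφ]
  have hcharged : ∀ j ∈ uu, Γ' (b j • ladderWord (cw j)) = C j * W j - W j * C j := by
    intro j hj
    rw [map_smul, hΓ', fermionEmbed_ladderWord]
    have hl : ladderCharge ((cw j).map emb) ≠ 0 ∨ ladderSpinCharge ((cw j).map emb) ≠ 0 := by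
      rw [hemb, ladderCharge_map_embMap, ladderSpinCharge_map_embMap]; exact hcw j hj
    exact smul_ladderWord_eq_commutator_of_charged (b j) _ hl
  -- residual words
  set M : κ'' → Matrix (Finset (Orb (FermionTorus 2 L))) (Finset (Orb (FermionTorus 2 L))) ℂ :=
    fun k => ladderWord ((word k).map emb) with hM
  have hMc : ∀ k ∈ w, (M k).IsContraction := fun k _ => by
    rw [hM]; dsimp only; rw [ladderWord_eq_prod]; exact isContraction_prod_ladder _
  -- the left-hand side, pulled back into the torus
  have hlhs : Γ' (Xw - (c : ℂ) • (1 : FermionOp Λ') -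
        ∑ σ : Fin 2, ((μ σ : ℝ) : ℂ) • (nAt 0 hz σ - ((ν : ℝ) : ℂ) • (1 : FermionOp Λ')) -
        ((κ : ℝ) : ℂ) • (((u : ℝ) : ℂ) • (1 : FermionOp Λ') - fermionEmbed (PolySite.incl h0) EΦ)) =
      Γ' Xw - (c : ℂ) • (1 : Matrix (Finset (Orb (FermionTorus 2 L))) (Finset (Orb (FermionTorus 2 L))) ℂ) -
        ∑ σ ∈ (Finset.univ : Finset (Fin 2)), ((μ σ : ℝ) : ℂ) • (D σ - ((ν : ℝ) : ℂ) •
          (1 : Matrix (Finset (Orb (FermionTorus 2 L))) (Finset (Orb (FermionTorus 2 L))) ℂ)) -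
        ((κ : ℝ) : ℂ) • (((u : ℝ) : ℂ) •
          (1 : Matrix (Finset (Orb (FermionTorus 2 L))) (Finset (Orb (FermionTorus 2 L))) ℂ) - X) := by
    have hs : Γ' (∑ σ : Fin 2, ((μ σ : ℝ) : ℂ) • (nAt 0 hz σ - ((ν : ℝ) : ℂ) • (1 : FermionOp Λ'))) =
        ∑ σ ∈ (Finset.univ : Finset (Fin 2)), ((μ σ : ℝ) : ℂ) • (D σ - ((ν : ℝ) : ℂ) •
          (1 : Matrix (Finset (Orb (FermionTorus 2 L))) (Finset (Orb (FermionTorus 2 L))) ℂ)) := by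
      rw [map_sum]
      exact Finset.sum_congr rfl fun σ _ => by rw [map_smul, map_sub, map_smul, map_one, hDΓ]
    have hk : Γ' (((κ : ℝ) : ℂ) • (((u : ℝ) : ℂ) • (1 : FermionOp Λ') - fermionEmbed (PolySite.incl h0) EΦ)) =
        ((κ : ℝ) : ℂ) • (((u : ℝ) : ℂ) •
          (1 : Matrix (Finset (Orb (FermionTorus 2 L))) (Finset (Orb (FermionTorus 2 L))) ℂ) - X) := by
      rw [map_smul, map_sub, map_smul, map_one, hX]
    rw [map_sub, hk, map_sub, hs, map_sub, map_smul, map_one]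
  -- the identity, pulled back into the torus
  have htorus : Γ' Xw - (c : ℂ) • (1 : Matrix (Finset (Orb (FermionTorus 2 L))) (Finset (Orb (FermionTorus 2 L))) ℂ) -
      ∑ σ ∈ (Finset.univ : Finset (Fin 2)), ((μ σ : ℝ) : ℂ) • (D σ - ((ν : ℝ) : ℂ) •
        (1 : Matrix (Finset (Orb (FermionTorus 2 L))) (Finset (Orb (FermionTorus 2 L))) ℂ)) -
      ((κ : ℝ) : ℂ) • (((u : ℝ) : ℂ) •
        (1 : Matrix (Finset (Orb (FermionTorus 2 L))) (Finset (Orb (FermionTorus 2 L))) ℂ) - X) =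
      gramForm Λm (fun i => Γ' (O i)) +
        (∑ k ∈ s, (H * Γ' (fermionEmbed (PolySite.incl hΛ) (B k)) - Γ' (fermionEmbed (PolySite.incl hΛ) (B k)) * H) +
          ∑ l ∈ tt, ((fockTranslate (Torus.proj L (wv l))).val * (fockD4 (L := L) (γ l)).val * Yt l *
              ((fockTranslate (Torus.proj L (wv l))).val * (fockD4 (L := L) (γ l)).val)ᴴ - Yt l) +
          ∑ i ∈ (∅ : Finset (Fin 0)), ((0 : Matrix _ _ ℂ) * ((0 : Matrix _ _ ℂ) - (((0 : ℝ) : ℝ) : ℂ) • 1) +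
            ((0 : Matrix _ _ ℂ) - (((0 : ℝ) : ℝ) : ℂ) • 1) * (0 : Matrix _ _ ℂ)) +
          ∑ j ∈ uu, (C j * W j - W j * C j)) +
        (∑ m' ∈ ah, ((dc m' : ℝ) : ℂ) • ((Γ' (V m'))ᴴ - Γ' (V m')) + ∑ k ∈ w, a k • M k) := by
    have key := congrArg Γ' hcert
    rw [hlhs] at key
    have h1' : Γ' (∑ k ∈ s, ((hubbardTTPrimeFermionInteraction t t' U).localHamiltonian Λ' * fermionEmbed (PolySite.incl hΛ) (B k) -
        fermionEmbed (PolySite.incl hΛ) (B k) * (hubbardTTPrimeFermionInteraction t t' U).localHamiltonian Λ')) =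
        ∑ k ∈ s, (H * Γ' (fermionEmbed (PolySite.incl hΛ) (B k)) - Γ' (fermionEmbed (PolySite.incl hΛ) (B k)) * H) := by
      rw [map_sum]
      refine Finset.sum_congr rfl fun k _ => ?_
      rw [hH, hΓ', hubbardTorusTT'_commutator_fermionEmbed L t t' U hΛ h8 hInj (B k)]
    have h2 : Γ' (∑ l ∈ tt, (fermionEmbed (PolySite.incl (hsh l)) (fermionEmbed (PolySite.d4Emb (γ l) (wv l) Λ) (Y l)) -
        fermionEmbed (PolySite.incl hΛ) (Y l))) =
        ∑ l ∈ tt, ((fockTranslate (Torus.proj L (wv l))).val * (fockD4 (L := L) (γ l)).val * Yt l *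
          ((fockTranslate (Torus.proj L (wv l))).val * (fockD4 (L := L) (γ l)).val)ᴴ - Yt l) := by
      rw [map_sum]
      refine Finset.sum_congr rfl fun l _ => ?_
      rw [hYt, hΓΛ, hΓ']
      exact fermionEmbed_toTorusEmb_d4_sub hΛ (γ l) (wv l) (hsh l) hInj' (Y l)
    have h3 : Γ' (∑ j ∈ uu, b j • ladderWord (cw j)) = ∑ j ∈ uu, (C j * W j - W j * C j) := by
      rw [map_sum]
      exact Finset.sum_congr rfl hcharged
    have h4 : Γ' (∑ m' ∈ ah, ((dc m' : ℝ) : ℂ) • ((V m')ᴴ - V m')) =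
        ∑ m' ∈ ah, ((dc m' : ℝ) : ℂ) • ((Γ' (V m'))ᴴ - Γ' (V m')) := by
      rw [map_sum]
      refine Finset.sum_congr rfl fun m' _ => ?_
      rw [map_smul, map_sub, hΓ', fermionEmbed_conjTranspose]
    have h5 : Γ' (∑ k ∈ w, a k • ladderWord (word k)) = ∑ k ∈ w, a k • M k := by
      rw [map_sum]
      refine Finset.sum_congr rfl fun k _ => ?_
      rw [map_smul, hM, hΓ', fermionEmbed_ladderWord]
    rw [key, map_add, map_add, map_add, map_add, map_add, hΓ', fermionEmbed_gramForm, ← hΓ', h1', h2, h3, h4, h5,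
      Finset.sum_empty, add_zero]
  have hmain := hubbardTorusTT'_re_orbitState_ge_of_local_certificate_ineq t t' U h1 hmul hψK hψ1 hHψ
    (Γ' Xw) X hsum κ u (Finset.univ : Finset (Fin 2)) μ (fun _ => ν) (fun _ => (nh : ℝ)) D G hDsum hGs hΛm
    (fun i => Γ' (O i)) s (fun k => Γ' (fermionEmbed (PolySite.incl hΛ) (B k))) tt γ hγS
    (fun l => Torus.proj L (wv l)) Yt
    (∅ : Finset (Fin 0)) (fun _ => 0) (fun _ => 0) (fun _ => 0) (fun _ => 0)
    (fun i hi => absurd hi (Finset.notMem_empty i)) (fun i hi => absurd hi (Finset.notMem_empty i))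
    uu C W qc hCh hCq ah dc (fun m' => Γ' (V m')) w a M hMc htorus
  have hs : ∑ σ ∈ (Finset.univ : Finset (Fin 2)), μ σ * ((nh : ℝ) / (L : ℝ) ^ 2 - ν) =
      (∑ σ : Fin 2, μ σ) * ((nh : ℝ) / (L : ℝ) ^ 2 - ν) := by rw [Finset.sum_mul]
  rw [hs] at hmain
  exact hmain

/-- **With the energy hypothesis**: under the hypotheses of
`re_orbitState_ge_of_window_certificate_d4_TT'_ineq`, `κ ≥ 0` and `E/L² ≤ u` give
`c − Σₖ ‖aₖ‖ + (Σ_σ μ_σ)(n/L² − ν) ≤ Re ω̄_ψ(Γ(ι_{Λ',L}) X)` for EVERY unit eigenvector `ψ` of the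
sector with energy `E ≤ u L²` — uniformly in `L`. Wang et al. 2024 §III. [cite: WangEtAl2024, §III] -/
theorem re_orbitState_ge_of_window_certificate_d4_TT'_ineq_of_energy_le (t t' U : ℝ) (hL : 3 ≤ L)
    {nh : ℕ}
    {Λ Λ' : Finset (Site 2)} (hΛ : Λ ⊆ Λ') (h8 : thicken Λ 1 ⊆ Λ')
    (h0 : thicken ({0} : Finset (Site 2)) 1 ⊆ Λ') (hz : (0 : Site 2) ∈ Λ')
    (hInj : Set.InjOn (Torus.proj (d := 2) L) ↑(thicken Λ' 1))
    (hInj' : Set.InjOn (Torus.proj (d := 2) L) ↑Λ')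
    {S : Finset (DihedralGroup 4)} (h1 : (1 : DihedralGroup 4) ∈ S) (hmul : ∀ a ∈ S, ∀ b ∈ S, a * b ∈ S)
    {ψ : Fock (Orb (FermionTorus 2 L))}
    (hψK : ψ ∈ (szSector (2 * nh) 0 : Submodule ℂ (Fock (Orb (FermionTorus 2 L)))))
    (hψ1 : star ψ ⬝ᵥ ψ = 1) {E : ℝ} (hHψ : hubbardTorusTT' L t t' U *ᵥ ψ = (E : ℂ) • ψ)
    {κ u : ℝ} (hκ : 0 ≤ κ) (hu : E / (L : ℝ) ^ 2 ≤ u) (Xw : FermionOp Λ') (μ : Fin 2 → ℝ) (ν : ℝ)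
    {m : Type*} [Fintype m] [DecidableEq m] {Λm : Matrix m m ℂ} (hΛm : Λm.PosSemidef)
    (O : m → FermionOp Λ')
    {κ' : Type*} (s : Finset κ') (B : κ' → FermionOp Λ)
    {ι : Type*} (tt : Finset ι) (γ : ι → DihedralGroup 4) (hγS : ∀ l ∈ tt, γ l ∈ S) (wv : ι → Site 2)
    (hsh : ∀ l, d4ShiftSet (γ l) (wv l) Λ ⊆ Λ') (Y : ι → FermionOp Λ)
    {ρ : Type*} (uu : Finset ρ) (b : ρ → ℂ) (cw : ρ → List (Orb (PolySite Λ') × Bool))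
    (hcw : ∀ j ∈ uu, ladderCharge (cw j) ≠ 0 ∨ ladderSpinCharge (cw j) ≠ 0)
    {δ : Type*} (ah : Finset δ) (dc : δ → ℝ) (V : δ → FermionOp Λ')
    {κ'' : Type*} (w : Finset κ'') (a : κ'' → ℂ) (word : κ'' → List (Orb (PolySite Λ') × Bool)) {c : ℝ}
    (hcert : Xw - (c : ℂ) • (1 : FermionOp Λ') -
        ∑ σ : Fin 2, ((μ σ : ℝ) : ℂ) • (nAt 0 hz σ - ((ν : ℝ) : ℂ) • (1 : FermionOp Λ')) -
        ((κ : ℝ) : ℂ) • (((u : ℝ) : ℂ) • (1 : FermionOp Λ') -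
          fermionEmbed (PolySite.incl h0) ((hubbardTTPrimeFermionInteraction t t' U).meanEnergyObs 1)) =
      gramForm Λm O +
        (∑ k ∈ s, ((hubbardTTPrimeFermionInteraction t t' U).localHamiltonian Λ' * fermionEmbed (PolySite.incl hΛ) (B k) -
            fermionEmbed (PolySite.incl hΛ) (B k) * (hubbardTTPrimeFermionInteraction t t' U).localHamiltonian Λ') +
          ∑ l ∈ tt, (fermionEmbed (PolySite.incl (hsh l)) (fermionEmbed (PolySite.d4Emb (γ l) (wv l) Λ) (Y l)) -
            fermionEmbed (PolySite.incl hΛ) (Y l)) +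
          ∑ j ∈ uu, b j • ladderWord (cw j)) +
        (∑ m' ∈ ah, ((dc m' : ℝ) : ℂ) • ((V m')ᴴ - V m') + ∑ k ∈ w, a k • ladderWord (word k))) :
    c - ∑ k ∈ w, ‖a k‖ + (∑ σ : Fin 2, μ σ) * ((nh : ℝ) / (L : ℝ) ^ 2 - ν) ≤
      (orbitState (spaceGroupUnitary S) ψ (fermionEmbed (PolySite.toTorusEmb L hInj') Xw)).re := by
  have h := re_orbitState_ge_of_window_certificate_d4_TT'_ineq t t' U hL hΛ h8 h0 hz hInj hInj' h1 hmul hψK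
    hψ1 hHψ Xw κ u μ ν hΛm O s B tt γ hγS wv hsh Y uu b cw hcw ah dc V w a word hcert
  have hslack : 0 ≤ κ * (u - E / (L : ℝ) ^ 2) := mul_nonneg hκ (sub_nonneg.2 hu)
  linarith

/-- **For every ground state of the sector.** Under the hypotheses of
`re_orbitState_ge_of_window_certificate_d4_TT'_ineq` with `κ ≥ 0` and a (certified) upper bound
`groundEnergy (hubbardTorusTT' L t t' U) (2n) / L² ≤ u` on the ground-state energy per site, EVERY unit
ground state `ψ` of the sector `(2n, S^z = 0)` — every vector of a degenerate ground level — obeys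
`c − Σₖ ‖aₖ‖ + (Σ_σ μ_σ)(n/L² − ν) ≤ Re ω̄_ψ(Γ(ι_{Λ',L}) X)`. Wang et al. 2024 §III (the ground
state is feasible for the energy constraint). [cite: WangEtAl2024, §III] -/
theorem re_orbitState_ge_of_window_certificate_d4_TT'_groundState (t t' U : ℝ) (hL : 3 ≤ L)
    {nh : ℕ} (hn : nh ≤ Fintype.card (FermionTorus 2 L))
    {Λ Λ' : Finset (Site 2)} (hΛ : Λ ⊆ Λ') (h8 : thicken Λ 1 ⊆ Λ')
    (h0 : thicken ({0} : Finset (Site 2)) 1 ⊆ Λ') (hz : (0 : Site 2) ∈ Λ')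
    (hInj : Set.InjOn (Torus.proj (d := 2) L) ↑(thicken Λ' 1))
    (hInj' : Set.InjOn (Torus.proj (d := 2) L) ↑Λ')
    {S : Finset (DihedralGroup 4)} (h1 : (1 : DihedralGroup 4) ∈ S) (hmul : ∀ a ∈ S, ∀ b ∈ S, a * b ∈ S)
    {ψ : Fock (Orb (FermionTorus 2 L))}
    (hGS : IsGroundStateInSector (hubbardTorusTT' L t t' U) (2 * nh) 0 ψ) (hψ1 : star ψ ⬝ᵥ ψ = 1)
    {κ u : ℝ} (hκ : 0 ≤ κ) (hu : groundEnergy (hubbardTorusTT' L t t' U) (2 * nh) / (L : ℝ) ^ 2 ≤ u)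
    (Xw : FermionOp Λ') (μ : Fin 2 → ℝ) (ν : ℝ)
    {m : Type*} [Fintype m] [DecidableEq m] {Λm : Matrix m m ℂ} (hΛm : Λm.PosSemidef)
    (O : m → FermionOp Λ')
    {κ' : Type*} (s : Finset κ') (B : κ' → FermionOp Λ)
    {ι : Type*} (tt : Finset ι) (γ : ι → DihedralGroup 4) (hγS : ∀ l ∈ tt, γ l ∈ S) (wv : ι → Site 2)
    (hsh : ∀ l, d4ShiftSet (γ l) (wv l) Λ ⊆ Λ') (Y : ι → FermionOp Λ)
    {ρ : Type*} (uu : Finset ρ) (b : ρ → ℂ) (cw : ρ → List (Orb (PolySite Λ') × Bool))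
    (hcw : ∀ j ∈ uu, ladderCharge (cw j) ≠ 0 ∨ ladderSpinCharge (cw j) ≠ 0)
    {δ : Type*} (ah : Finset δ) (dc : δ → ℝ) (V : δ → FermionOp Λ')
    {κ'' : Type*} (w : Finset κ'') (a : κ'' → ℂ) (word : κ'' → List (Orb (PolySite Λ') × Bool)) {c : ℝ}
    (hcert : Xw - (c : ℂ) • (1 : FermionOp Λ') -
        ∑ σ : Fin 2, ((μ σ : ℝ) : ℂ) • (nAt 0 hz σ - ((ν : ℝ) : ℂ) • (1 : FermionOp Λ')) -
        ((κ : ℝ) : ℂ) • (((u : ℝ) : ℂ) • (1 : FermionOp Λ') -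
          fermionEmbed (PolySite.incl h0) ((hubbardTTPrimeFermionInteraction t t' U).meanEnergyObs 1)) =
      gramForm Λm O +
        (∑ k ∈ s, ((hubbardTTPrimeFermionInteraction t t' U).localHamiltonian Λ' * fermionEmbed (PolySite.incl hΛ) (B k) -
            fermionEmbed (PolySite.incl hΛ) (B k) * (hubbardTTPrimeFermionInteraction t t' U).localHamiltonian Λ') +
          ∑ l ∈ tt, (fermionEmbed (PolySite.incl (hsh l)) (fermionEmbed (PolySite.d4Emb (γ l) (wv l) Λ) (Y l)) -
            fermionEmbed (PolySite.incl hΛ) (Y l)) +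
          ∑ j ∈ uu, b j • ladderWord (cw j)) +
        (∑ m' ∈ ah, ((dc m' : ℝ) : ℂ) • ((V m')ᴴ - V m') + ∑ k ∈ w, a k • ladderWord (word k))) :
    c - ∑ k ∈ w, ‖a k‖ + (∑ σ : Fin 2, μ σ) * ((nh : ℝ) / (L : ℝ) ^ 2 - ν) ≤
      (orbitState (spaceGroupUnitary S) ψ (fermionEmbed (PolySite.toTorusEmb L hInj') Xw)).re := by
  have hψK : ψ ∈ (szSector (2 * nh) 0 : Submodule ℂ (Fock (Orb (FermionTorus 2 L)))) := hGS.1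
  have hHψ : hubbardTorusTT' L t t' U *ᵥ ψ =
      ((groundEnergy (hubbardTorusTT' L t t' U) (2 * nh) : ℝ) : ℂ) • ψ := by
    rw [groundEnergy_hubbardTorusTT'_eq_minEnergyOn_szSector L t t' U hn]
    exact hGS.2.2
  exact re_orbitState_ge_of_window_certificate_d4_TT'_ineq_of_energy_le t t' U hL hΛ h8 h0 hz hInj hInj' h1
    hmul hψK hψ1 hHψ hκ hu Xw μ ν hΛm O s B tt γ hγS wv hsh Y uu b cw hcw ah dc V w a word hcert

end Window

end Literature.MathematicalPhysics.QuantumLattice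

end
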